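import Summits.QuantumFields.YangMills.Theorems.BalabanUVNodesK2NamedJetsLimit

/-!
# Crux K2⁷ `EndpointGivenBR13SepCoPH` (stmt-QuantumFields-20543) — THE KERNEL PRICE OF THE (β2) «CLASS PAIR» RE-DEAL OF v6's (D1) STUB: uniformity of the run letter over a
# CLASS of colour maps = the pinned (β1) text at ANY ONE member + SEQUENCE-RIGIDITY of the class; over the full drift class `KAdm` it makes the drift variety ONE fibre of the
# named-numbers map `κ ↦ beta0OfJs F κ` at every block carrying one inhabited crux prefix (else the prefix is uninhabited there)

Cell `ym-nodeO-ideate`, seat `ym-nodeO-d1-w2` (gen 2; explicit unit; director-ym R399 (3a) ∕ №25 (3) ∕ №206 «land `stub_d1AnchoredJets13 : D1AtAnchoredJets` via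
`d1AtAnchoredJets_of_d1Drift_all`, coordinate with the (D1) desks»).  `--kind proof --supports stmt-QuantumFields-20543 --as helper`; count-neutral.  Registered skeleton of
record: v6 `5a75a2378c79b303` (stubs `stub_d1AnchoredJets13 : D1AtAnchoredJets`, `stub_runRemNamedJets13 : RunRemAtSomeJets`).  Lineage: gen 0 of this seat landed the price of
the DEALT use form («(D1) at every colour datum», `…K2D1DriftAllPrice`, p608845); seat `ym-nodeO-d1-w1` landed the hypothesis-free limit ∕ anchor junctions and the verdict «1ᴬ
stub-misstated AS DEALT» (`…K2NamedJetsLimit`, p607079), adopted by the planner of record (plan g83 WORDS-3) together with the v7 triggers (β1) PIN ∕ (β2) CLASS ∕ (β3) OWN DRIFT.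

THE OBJECT PRICED HERE — plan g83 WORDS-3's (β2) «CLASS PAIR» (texts INLINE below; `KAdm κ := ∀ F, ∃ A, OneLoopDrift (stepBal 2 F.L) A (beta0OfJs F (κ F.L))` for colour maps
`κ : ℕ → StepColourData`, one colour datum per block):
* 1ᴰ (θ-free, D1 side): `∃ κ, KAdm κ` — ONE colour map on the drift variety of every family;
* 2ᴼ (NODE O side): `∀ κ, KAdm κ → ∀ F θ hP, ‹v6 prefix› → RunRemAt F (κ F.L) θ hP θ.cβ` — DEF-1's run letter (p596574 :175) UNIFORMLY over the class, «or a NAMED sub-class»;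
composed at the witness through DEF-1's `K2V6Defs.EndpointGivenBR13SepCoPH_of_pin` (p606356 §4).  The planner's own caveat: «uniformity may be FALSE … then (β1) is the road; say
so and (β2) dies».  This file says, in the kernel, WHAT uniformity over a class asserts — for ANY class `K` of colour maps (a `Prop`-valued predicate, parametric; nothing named):
* §1 `runRemAt_congr_of_beta0OfJs_eq`: the colour datum enters the run letter ONLY through its named sequence `beta0OfJs F κ` (so the letter cannot tell two data in one fibre of
  `κ ↦ beta0OfJs F κ` apart); `beta0OfJs_eq_of_L_eq`: the named numbers read the family only through its block `F.L`.
* §2 ★★ `classUniform_iff_pin_and_rigid`: for every class `K` and every member `κ⋆ ∈ K`, 2ᴼ over `K` ⟺ [(β1)'s pinned run text AT `κ⋆`] ∧ [RIGIDITY: every member of `K` has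
  `κ⋆`'s named SEQUENCE (all levels, not only the limit) at every block carrying a tuple with the v6 prefix] — anchor uniqueness at `θ.cβ ≠ 0` (`beta0OfJs_eq_of_runRemAt_adm`,
  p596574 :206) one way, §1 the other.  So 2ᴼ over a class is (β1) at one member PLUS «the class names ONE sequence per inhabited block»: (β2) is not a third road.
* §3 ★★ the plan's own text, `K := KAdm`: 2ᴼ(KAdm) together with ONE member `κ⋆ ∈ KAdm` (= 1ᴰ's witness) forces, at every family carrying ONE tuple with the v6 prefix, the WHOLE
  drift variety `{κ₀ | CauchyRate.lim (beta0OfJs F κ₀) = stepBal 2 F.L}` into the single fibre `{κ₀ | beta0OfJs F κ₀ = beta0OfJs F (κ⋆ F.L)}` — indeed variety = fibre there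
  (`variety_iff_fibre_of_classUniform`; the update-at-one-block trick, `Function.update`); contrapositively (`prefix_uninhabited_of_classUniform_of_two_sequences`) TWO variety
  members with DIFFERENT named sequences at a block make K2⁷'s hypothesis prefix UNINHABITED at every tuple of every family of that block under 2ᴼ(KAdm) — the crux would hold
  there vacuously.  Whether the variety is a fibre is print's UNCOMPUTED data (0 coefficients in the tree); by gen 0's `…K2D1DriftAllPrice` §1 the limit is ONE quartic normal form in
  the datum while the level-`j` numbers are other functions of it, so «variety ⊆ one fibre» is a rigidity nobody has asserted — it is the price tag of 2ᴼ(KAdm), displayed, not paid.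
* §4 by-name bookkeeping: the class pair ⟹ the crux decl (`EndpointGivenBR13SepCoPH_of_classPair`, via `…_of_pin` at the witness) and ⟹ v6's registered pair; the rigid re-reading
  «2ᴼ over a class = 2 at a pin» (`classUniform_of_pin_of_rigid`).

HONEST FRAMING.  [folklore] bookkeeping BY NAME over tree letters (DEF-1's `RunRemAt` ∕ `K2V6Defs`, seat d1-w1's `drift_iff_lim_eq`, anchor uniqueness `ScaleAnchor.eq_of_smul`) and
`Function.update`; NOTHING of Bałaban's analysis is asserted; NO coefficient ∕ limit ∕ sequence is computed or compared; (D1) is NOT discharged at any colour datum; (P6) NOT decided;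
NO stub is proved (1ᴬ as dealt is record-side — gen 0 ∕ d1-w1 verdict of record; 2ᴮ″ is NODE O's wall); every theorem is an implication between DISPLAYED hypothesis shapes
(instance 0∕1); the skeleton v6 is untouched and no cut is recommended here (the plan's call).  K2⁷ OPEN (v6: 2 registered stubs, 0 closed); counts UNMOVED (typed 28∕28 · discharged
5∕27 (A 5∕28)); [Balaban1987RG1] Thm 2 + (0.31) p. 259 (NODE O) UNPROVED IN PRINT; route R4 closes the CONDITIONAL finite-𝕋⁴ rung `BalabanLadder.UV` only — NOT continuum, NOT ℝ⁴,
NOT OS, NOT a mass gap; the Clay YM mass-gap problem is NOT proved by any of this; no summit statement is proved by this seat.  No `def`, no `instance`, no `notation`, no `axiom`,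
0 `sorry`.  Sources (context only; nothing printed is used as a hypothesis): [I] = [Balaban1987RG1] CMP **109** (1987): Thm 2 p. 259 (first sentence), (1.3) p. 260, Thm 3 p. 264,
(2.12)–(2.14) p. 268, (5.10) p. 293.
-/

noncomputable section

namespace Summit.QuantumFields.YangMills.Theorems.BalabanUVNodesK2D1ClassPairPrice

open Filter Topology
open Literature.MathematicalPhysics.QuantumFieldTheory.Balaban1983to89
open Literature.MathematicalPhysics.QuantumFieldTheory.Balaban1983to89.T4Continuum (T4Family)
open Literature.MathematicalPhysics.QuantumFieldTheory.Balaban1983to89.Beta.Drift (OneLoopDrift)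
open Literature.MathematicalPhysics.QuantumFieldTheory.Balaban1983to89.Beta.RateCertificate (CauchyRate)
open Summit.QuantumFields.YangMills.Theorems.BalabanUVNodesK2JsOfRecord (StepColourData JsOfRecord beta0OfJs)
open Summit.QuantumFields.YangMills.Theorems.BalabanUVNodesK2NamedJetsRemAt (ScaleAnchor)
open Summit.QuantumFields.YangMills.Theorems.BalabanUVNodesK2NamedJetsRunRemAt (RunRemAt beta0OfJs_eq_of_runRemAt_adm)
open Summit.QuantumFields.YangMills.Theorems.BalabanUVNodesK2V6Defs (Window13 D1AtAnchoredJets RunRemAtSomeJets EndpointGivenBR13SepCoPH_of_pin d1AtAnchoredJets_of_pin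
  runRemAtSomeJets_of_pin)
open Summit.QuantumFields.YangMills.Theorems.BalabanUVNodesK2NamedJetsLimit (drift_iff_lim_eq)

/-! ## §1 The colour datum enters the run letter only through its named sequence; the named numbers read the family only through its block -/

section Congr

/-- **THE RUN LETTER READS κ ONLY THROUGH `beta0OfJs F κ`**: two colour data with the same named one-loop sequence have the same run letter at every tuple and every scale
(DEF-1's `RunRemAt`, p596574 :175 — `κ` occurs in it only inside `fun k => c * beta0OfJs F κ k`).  So no statement keyed on `RunRemAt` separates data in one fibre of
`κ ↦ beta0OfJs F κ`. [folklore] -/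
theorem runRemAt_congr_of_beta0OfJs_eq (F : T4Family) {κ κ' : StepColourData} (θ : Node00.Stage13HParams F 2) (hP : θ.Provisos₁₃SepCoPH F 2) (c : ℝ)
    (h : beta0OfJs F κ = beta0OfJs F κ') : RunRemAt F κ θ hP c ↔ RunRemAt F κ' θ hP c := by
  unfold RunRemAt
  rw [h]

/-- … the same for the anchor conjunct alone. [folklore] -/
theorem scaleAnchor_congr_of_beta0OfJs_eq (F : T4Family) {κ κ' : StepColourData} (θ : Node00.Stage13HParams F 2) (hP : θ.Provisos₁₃SepCoPH F 2) (c : ℝ)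
    (h : beta0OfJs F κ = beta0OfJs F κ') :
    ScaleAnchor (Node00.datumOfRecord₁₃SepCoPH F 2 θ hP).βfun (fun k => c * beta0OfJs F κ k) ↔
      ScaleAnchor (Node00.datumOfRecord₁₃SepCoPH F 2 θ hP).βfun (fun k => c * beta0OfJs F κ' k) := by
  rw [h]

/-- **THE NAMED NUMBERS READ THE FAMILY ONLY THROUGH ITS BLOCK**: `F.L = F'.L ⟹ beta0OfJs F κ = beta0OfJs F' κ` (the torus exponent `F.m` is unread; the block proofs enter
proof-irrelevantly). [folklore] -/
theorem beta0OfJs_eq_of_L_eq {F F' : T4Family} (h : F.L = F'.L) (κ : StepColourData) : beta0OfJs F κ = beta0OfJs F' κ := by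
  obtain ⟨L, hL, hL11, m, hm⟩ := F
  obtain ⟨L', hL', hL11', m', hm'⟩ := F'
  simp only at h
  subst h
  rfl

/-- … hence the drift-variety membership of a colour datum depends on the family only through its block. [folklore] -/
theorem lim_eq_stepBal_of_L_eq {F F' : T4Family} (h : F.L = F'.L) {κ : StepColourData}
    (hκ : CauchyRate.lim (beta0OfJs F κ) = B12Normalization.stepBal 2 F.L) : CauchyRate.lim (beta0OfJs F' κ) = B12Normalization.stepBal 2 F'.L := by
  rw [← beta0OfJs_eq_of_L_eq h, ← h]
  exact hκ

end Congr

/-! ## §2 For ANY class of colour maps: uniformity of the run letter over the class ⟺ the pinned text at one member ∧ sequence-rigidity of the class -/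

section AnyClass

variable (K : (ℕ → StepColourData) → Prop)

/-- **★ UNIFORMITY OVER A CLASS FORCES ONE NAMED SEQUENCE PER INHABITED BLOCK**: if the run letter holds under the v6 prefix for EVERY member of a class `K` (2ᴼ over `K`), then
any two members have the SAME named one-loop sequence `beta0OfJs F (κ F.L)` at every family carrying a tuple with the prefix (both anchor the same admissible record at the scale
`θ.cβ > 0`: `beta0OfJs_eq_of_runRemAt_adm`, p596574 :206).  Equality of SEQUENCES — every level `j` — not merely of limits. [folklore] -/
theorem beta0OfJs_eq_of_classUniform
    (h2 : ∀ κ : ℕ → StepColourData, K κ → ∀ (F : T4Family) (θ : Node00.Stage13HParams F 2) (hP : θ.Provisos₁₃SepCoPH F 2),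
      (θ.ZhUnity F 2 ∧ θ.SlotsNondegenerate₁₃ F 2) → θ.Admissible F 2 → B16.EndStatementBPrinted (Node00.datumOfRecord₁₃SepCoPH F 2 θ hP).C → Window13 F θ hP →
      RunRemAt F (κ F.L) θ hP θ.cβ)
    {κ₁ κ₂ : ℕ → StepColourData} (hκ₁ : K κ₁) (hκ₂ : K κ₂)
    (F : T4Family) (θ : Node00.Stage13HParams F 2) (hP : θ.Provisos₁₃SepCoPH F 2) (hU : θ.ZhUnity F 2 ∧ θ.SlotsNondegenerate₁₃ F 2) (hθ : θ.Admissible F 2)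
    (hB : B16.EndStatementBPrinted (Node00.datumOfRecord₁₃SepCoPH F 2 θ hP).C) (hwin : Window13 F θ hP) :
    beta0OfJs F (κ₁ F.L) = beta0OfJs F (κ₂ F.L) :=
  beta0OfJs_eq_of_runRemAt_adm F (κ₁ F.L) (κ₂ F.L) θ hP hθ (h2 κ₁ hκ₁ F θ hP hU hθ hB hwin) (h2 κ₂ hκ₂ F θ hP hU hθ hB hwin)

/-- **★★ 2ᴼ OVER ANY CLASS `K` ∋ `κ⋆` ⟺ (β1)'s PINNED RUN TEXT AT `κ⋆` ∧ SEQUENCE-RIGIDITY OF `K`** (rigidity: every member of `K` has `κ⋆`'s named sequence at every block carrying a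
tuple with the v6 prefix).  (→) anchor uniqueness (`beta0OfJs_eq_of_classUniform`); (←) the run letter reads κ only through its sequence (§1).  READING: uniformity over a class buys
nothing beyond the pin except the assertion that the class lies in ONE fibre of `κ ↦ beta0OfJs F κ` per inhabited block — (β2) = (β1) at a member + that assertion.  Nothing here says
whether any proposed class is rigid (0 sequences compared in the tree). [folklore] -/
theorem classUniform_iff_pin_and_rigid {κs : ℕ → StepColourData} (hκs : K κs) :
    (∀ κ : ℕ → StepColourData, K κ → ∀ (F : T4Family) (θ : Node00.Stage13HParams F 2) (hP : θ.Provisos₁₃SepCoPH F 2),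
        (θ.ZhUnity F 2 ∧ θ.SlotsNondegenerate₁₃ F 2) → θ.Admissible F 2 → B16.EndStatementBPrinted (Node00.datumOfRecord₁₃SepCoPH F 2 θ hP).C → Window13 F θ hP →
        RunRemAt F (κ F.L) θ hP θ.cβ) ↔
      ((∀ (F : T4Family) (θ : Node00.Stage13HParams F 2) (hP : θ.Provisos₁₃SepCoPH F 2),
          (θ.ZhUnity F 2 ∧ θ.SlotsNondegenerate₁₃ F 2) → θ.Admissible F 2 → B16.EndStatementBPrinted (Node00.datumOfRecord₁₃SepCoPH F 2 θ hP).C → Window13 F θ hP →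
          RunRemAt F (κs F.L) θ hP θ.cβ) ∧
        ∀ κ : ℕ → StepColourData, K κ → ∀ (F : T4Family) (θ : Node00.Stage13HParams F 2) (hP : θ.Provisos₁₃SepCoPH F 2),
          (θ.ZhUnity F 2 ∧ θ.SlotsNondegenerate₁₃ F 2) → θ.Admissible F 2 → B16.EndStatementBPrinted (Node00.datumOfRecord₁₃SepCoPH F 2 θ hP).C → Window13 F θ hP →
          beta0OfJs F (κ F.L) = beta0OfJs F (κs F.L)) := by
  refine ⟨fun h2 => ⟨h2 κs hκs, fun κ hκ F θ hP hU hθ hB hwin => beta0OfJs_eq_of_classUniform K h2 hκ hκs F θ hP hU hθ hB hwin⟩, ?_⟩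
  rintro ⟨hpin, hrig⟩ κ hκ F θ hP hU hθ hB hwin
  exact (runRemAt_congr_of_beta0OfJs_eq F θ hP θ.cβ (hrig κ hκ F θ hP hU hθ hB hwin)).mpr (hpin F θ hP hU hθ hB hwin)

/-- USE FORM of (←) («2 at a pin + rigidity of the class ⟹ 2ᴼ over the class»): a class known to name ONE sequence per inhabited block is served by the pinned text at any member.
[folklore] -/
theorem classUniform_of_pin_of_rigid {κs : ℕ → StepColourData}
    (hpin : ∀ (F : T4Family) (θ : Node00.Stage13HParams F 2) (hP : θ.Provisos₁₃SepCoPH F 2),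
      (θ.ZhUnity F 2 ∧ θ.SlotsNondegenerate₁₃ F 2) → θ.Admissible F 2 → B16.EndStatementBPrinted (Node00.datumOfRecord₁₃SepCoPH F 2 θ hP).C → Window13 F θ hP →
      RunRemAt F (κs F.L) θ hP θ.cβ)
    (hrig : ∀ κ : ℕ → StepColourData, K κ → ∀ (F : T4Family) (θ : Node00.Stage13HParams F 2) (hP : θ.Provisos₁₃SepCoPH F 2),
      (θ.ZhUnity F 2 ∧ θ.SlotsNondegenerate₁₃ F 2) → θ.Admissible F 2 → B16.EndStatementBPrinted (Node00.datumOfRecord₁₃SepCoPH F 2 θ hP).C → Window13 F θ hP →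
      beta0OfJs F (κ F.L) = beta0OfJs F (κs F.L)) :
    ∀ κ : ℕ → StepColourData, K κ → ∀ (F : T4Family) (θ : Node00.Stage13HParams F 2) (hP : θ.Provisos₁₃SepCoPH F 2),
      (θ.ZhUnity F 2 ∧ θ.SlotsNondegenerate₁₃ F 2) → θ.Admissible F 2 → B16.EndStatementBPrinted (Node00.datumOfRecord₁₃SepCoPH F 2 θ hP).C → Window13 F θ hP →
      RunRemAt F (κ F.L) θ hP θ.cβ :=
  fun κ hκ F θ hP hU hθ hB hwin => (runRemAt_congr_of_beta0OfJs_eq F θ hP θ.cβ (hrig κ hκ F θ hP hU hθ hB hwin)).mpr (hpin F θ hP hU hθ hB hwin)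

/-- **THE CLASS PAIR CONCLUDES THE CRUX DECL BY NAME** (for completeness; one line over DEF-1's `K2V6Defs.EndpointGivenBR13SepCoPH_of_pin` at 1ᴰ's witness — only the witness's
instance of 2ᴼ is consumed, uniformity over the rest of `K` is UNREAD by the composition).  CONDITIONAL on the two displayed texts; K2⁷ NOT closed; nothing of Bałaban asserted.
[cite: Balaban1987RG1, Thm 2 p.259 (first sentence), Thm 3 p.264 and (2.12)–(2.14) p.268] -/
theorem EndpointGivenBR13SepCoPH_of_classPair
    (h1 : ∃ κ : ℕ → StepColourData, K κ ∧ ∀ F : T4Family, ∃ A : ℝ, OneLoopDrift (B12Normalization.stepBal 2 F.L) A (beta0OfJs F (κ F.L)))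
    (h2 : ∀ κ : ℕ → StepColourData, K κ → ∀ (F : T4Family) (θ : Node00.Stage13HParams F 2) (hP : θ.Provisos₁₃SepCoPH F 2),
      (θ.ZhUnity F 2 ∧ θ.SlotsNondegenerate₁₃ F 2) → θ.Admissible F 2 → B16.EndStatementBPrinted (Node00.datumOfRecord₁₃SepCoPH F 2 θ hP).C → Window13 F θ hP →
      RunRemAt F (κ F.L) θ hP θ.cβ) :
    Summit.QuantumFields.YangMills.Theses.BalabanUVNodes.EndpointGivenBR13SepCoPH := by
  obtain ⟨κs, hK, hD1⟩ := h1
  exact EndpointGivenBR13SepCoPH_of_pin κs hD1 (h2 κs hK)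

end AnyClass

/-! ## §3 The plan's own class `KAdm` (every colour map on the drift variety of every family): uniformity makes the drift variety ONE fibre of the named-numbers map -/

section DriftClass

/-- (update at one block) from ONE colour map `κ⋆` on the drift variety of every family and ONE colour datum `κ₀` on the drift variety of the family `F`, the map
`Function.update κ⋆ F.L κ₀` is again on the drift variety of every family (families of block `F.L` read `κ₀` — `beta0OfJs` reads only the block, §1 — the others read `κ⋆`). [folklore] -/
theorem driftClass_update {κs : ℕ → StepColourData}
    (hκs : ∀ F : T4Family, ∃ A : ℝ, OneLoopDrift (B12Normalization.stepBal 2 F.L) A (beta0OfJs F (κs F.L)))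
    (F : T4Family) {κ₀ : StepColourData} (hκ₀ : CauchyRate.lim (beta0OfJs F κ₀) = B12Normalization.stepBal 2 F.L) :
    ∀ F' : T4Family, ∃ A : ℝ, OneLoopDrift (B12Normalization.stepBal 2 F'.L) A (beta0OfJs F' (Function.update κs F.L κ₀ F'.L)) := by
  intro F'
  by_cases hL : F'.L = F.L
  · rw [hL, Function.update_self, beta0OfJs_eq_of_L_eq hL κ₀]
    exact (drift_iff_lim_eq F κ₀ 2).mpr hκ₀
  · rw [Function.update_of_ne hL]
    exact hκs F'

/-- **★★ THE PRICE OF 2ᴼ OVER THE FULL DRIFT CLASS `KAdm`, AS A KERNEL STATEMENT**: if the run letter holds under the v6 prefix for EVERY colour map on the drift variety of every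
family (the plan's 2ᴼ) and ONE such map `κ⋆` exists (1ᴰ's witness), then at every family `F` carrying ONE tuple with the v6 prefix EVERY colour datum on the drift variety
`CauchyRate.lim (beta0OfJs F κ₀) = stepBal 2 F.L` has `κ⋆ F.L`'s FULL named sequence: `beta0OfJs F κ₀ = beta0OfJs F (κ⋆ F.L)` — the variety lies in ONE fibre of
`κ ↦ beta0OfJs F κ` (proof: 2ᴼ at `Function.update κ⋆ F.L κ₀` and at `κ⋆`, anchor uniqueness at `θ.cβ > 0`).  A rigidity of print's colour dependence that no desk has
asserted and no coefficient in the tree decides — displayed here as what 2ᴼ(KAdm) costs, not paid. [folklore] -/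
theorem beta0OfJs_eq_of_driftClassUniform {κs : ℕ → StepColourData}
    (hκs : ∀ F : T4Family, ∃ A : ℝ, OneLoopDrift (B12Normalization.stepBal 2 F.L) A (beta0OfJs F (κs F.L)))
    (h2 : ∀ κ : ℕ → StepColourData, (∀ F : T4Family, ∃ A : ℝ, OneLoopDrift (B12Normalization.stepBal 2 F.L) A (beta0OfJs F (κ F.L))) →
      ∀ (F : T4Family) (θ : Node00.Stage13HParams F 2) (hP : θ.Provisos₁₃SepCoPH F 2),
      (θ.ZhUnity F 2 ∧ θ.SlotsNondegenerate₁₃ F 2) → θ.Admissible F 2 → B16.EndStatementBPrinted (Node00.datumOfRecord₁₃SepCoPH F 2 θ hP).C → Window13 F θ hP →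
      RunRemAt F (κ F.L) θ hP θ.cβ)
    (F : T4Family) (θ : Node00.Stage13HParams F 2) (hP : θ.Provisos₁₃SepCoPH F 2) (hU : θ.ZhUnity F 2 ∧ θ.SlotsNondegenerate₁₃ F 2) (hθ : θ.Admissible F 2)
    (hB : B16.EndStatementBPrinted (Node00.datumOfRecord₁₃SepCoPH F 2 θ hP).C) (hwin : Window13 F θ hP)
    {κ₀ : StepColourData} (hκ₀ : CauchyRate.lim (beta0OfJs F κ₀) = B12Normalization.stepBal 2 F.L) :
    beta0OfJs F κ₀ = beta0OfJs F (κs F.L) := by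
  have h := beta0OfJs_eq_of_classUniform (fun κ => ∀ F : T4Family, ∃ A : ℝ, OneLoopDrift (B12Normalization.stepBal 2 F.L) A (beta0OfJs F (κ F.L))) h2
    (driftClass_update hκs F hκ₀) hκs F θ hP hU hθ hB hwin
  rwa [Function.update_self] at h

/-- **★ … SO AT SUCH A FAMILY THE DRIFT VARIETY *IS* THE FIBRE OF `κ⋆ F.L`**: `CauchyRate.lim (beta0OfJs F κ₀) = stepBal 2 F.L ⟺ beta0OfJs F κ₀ = beta0OfJs F (κ⋆ F.L)` for every colour
datum `κ₀` (← : same sequence, same limit, and `κ⋆` is on the variety — d1-w1's `drift_iff_lim_eq`).  Under 2ᴼ(KAdm) ∧ 1ᴰ the ONE real equation «lim = stepBal» in the datum and the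
INFINITELY MANY equations «level-`j` number = `κ⋆`'s» cut out the same set wherever K2⁷'s surface is inhabited. [folklore] -/
theorem variety_iff_fibre_of_driftClassUniform {κs : ℕ → StepColourData}
    (hκs : ∀ F : T4Family, ∃ A : ℝ, OneLoopDrift (B12Normalization.stepBal 2 F.L) A (beta0OfJs F (κs F.L)))
    (h2 : ∀ κ : ℕ → StepColourData, (∀ F : T4Family, ∃ A : ℝ, OneLoopDrift (B12Normalization.stepBal 2 F.L) A (beta0OfJs F (κ F.L))) →
      ∀ (F : T4Family) (θ : Node00.Stage13HParams F 2) (hP : θ.Provisos₁₃SepCoPH F 2),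
      (θ.ZhUnity F 2 ∧ θ.SlotsNondegenerate₁₃ F 2) → θ.Admissible F 2 → B16.EndStatementBPrinted (Node00.datumOfRecord₁₃SepCoPH F 2 θ hP).C → Window13 F θ hP →
      RunRemAt F (κ F.L) θ hP θ.cβ)
    (F : T4Family) (θ : Node00.Stage13HParams F 2) (hP : θ.Provisos₁₃SepCoPH F 2) (hU : θ.ZhUnity F 2 ∧ θ.SlotsNondegenerate₁₃ F 2) (hθ : θ.Admissible F 2)
    (hB : B16.EndStatementBPrinted (Node00.datumOfRecord₁₃SepCoPH F 2 θ hP).C) (hwin : Window13 F θ hP) (κ₀ : StepColourData) :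
    CauchyRate.lim (beta0OfJs F κ₀) = B12Normalization.stepBal 2 F.L ↔ beta0OfJs F κ₀ = beta0OfJs F (κs F.L) := by
  refine ⟨fun hκ₀ => beta0OfJs_eq_of_driftClassUniform hκs h2 F θ hP hU hθ hB hwin hκ₀, fun hfib => ?_⟩
  rw [hfib]
  exact (drift_iff_lim_eq F (κs F.L) 2).mp (hκs F)

/-- … the same rigidity in the registered DRIFT currency and LEVEL BY LEVEL: under 2ᴼ(KAdm) with witness `κ⋆`, at a family carrying one prefixed tuple, every colour datum whose named
numbers drift with Bałaban's slope has `beta0OfJs F κ₀ j = beta0OfJs F (κ⋆ F.L) j` at EVERY level `j` — level `0` included (no limit taken). [folklore] -/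
theorem beta0OfJs_apply_eq_of_driftClassUniform {κs : ℕ → StepColourData}
    (hκs : ∀ F : T4Family, ∃ A : ℝ, OneLoopDrift (B12Normalization.stepBal 2 F.L) A (beta0OfJs F (κs F.L)))
    (h2 : ∀ κ : ℕ → StepColourData, (∀ F : T4Family, ∃ A : ℝ, OneLoopDrift (B12Normalization.stepBal 2 F.L) A (beta0OfJs F (κ F.L))) →
      ∀ (F : T4Family) (θ : Node00.Stage13HParams F 2) (hP : θ.Provisos₁₃SepCoPH F 2),
      (θ.ZhUnity F 2 ∧ θ.SlotsNondegenerate₁₃ F 2) → θ.Admissible F 2 → B16.EndStatementBPrinted (Node00.datumOfRecord₁₃SepCoPH F 2 θ hP).C → Window13 F θ hP →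
      RunRemAt F (κ F.L) θ hP θ.cβ)
    (F : T4Family) (θ : Node00.Stage13HParams F 2) (hP : θ.Provisos₁₃SepCoPH F 2) (hU : θ.ZhUnity F 2 ∧ θ.SlotsNondegenerate₁₃ F 2) (hθ : θ.Admissible F 2)
    (hB : B16.EndStatementBPrinted (Node00.datumOfRecord₁₃SepCoPH F 2 θ hP).C) (hwin : Window13 F θ hP)
    {κ₀ : StepColourData} (hκ₀ : ∃ A : ℝ, OneLoopDrift (B12Normalization.stepBal 2 F.L) A (beta0OfJs F κ₀)) (j : ℕ) :
    beta0OfJs F κ₀ j = beta0OfJs F (κs F.L) j :=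
  congrFun (beta0OfJs_eq_of_driftClassUniform hκs h2 F θ hP hU hθ hB hwin ((drift_iff_lim_eq F κ₀ 2).mp hκ₀)) j

/-- **★ CONTRAPOSITIVE — THE VACUITY READING**: under 2ᴼ(KAdm) with a witness `κ⋆ ∈ KAdm`, TWO colour data on the drift variety of a family `F` with DIFFERENT named sequences make
K2⁷'s hypothesis prefix UNINHABITED at EVERY Stage-13 tuple of `F`: no `θ, hP` carries unity ∧ slots ∧ admissibility ∧ (B) ∧ the window — the crux would hold at `F` vacuously.
So a proof of 2ᴼ(KAdm) is EITHER a fibre statement about print's colour dependence OR an emptiness proof of the crux's own surface at that block.  Nothing here says which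
(0 sequences compared; the surface's inhabitation is K1⁷'s business). [folklore] -/
theorem prefix_uninhabited_of_driftClassUniform_of_two_sequences {κs : ℕ → StepColourData}
    (hκs : ∀ F : T4Family, ∃ A : ℝ, OneLoopDrift (B12Normalization.stepBal 2 F.L) A (beta0OfJs F (κs F.L)))
    (h2 : ∀ κ : ℕ → StepColourData, (∀ F : T4Family, ∃ A : ℝ, OneLoopDrift (B12Normalization.stepBal 2 F.L) A (beta0OfJs F (κ F.L))) →
      ∀ (F : T4Family) (θ : Node00.Stage13HParams F 2) (hP : θ.Provisos₁₃SepCoPH F 2),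
      (θ.ZhUnity F 2 ∧ θ.SlotsNondegenerate₁₃ F 2) → θ.Admissible F 2 → B16.EndStatementBPrinted (Node00.datumOfRecord₁₃SepCoPH F 2 θ hP).C → Window13 F θ hP →
      RunRemAt F (κ F.L) θ hP θ.cβ)
    (F : T4Family) {κ₁ κ₂ : StepColourData} (hκ₁ : CauchyRate.lim (beta0OfJs F κ₁) = B12Normalization.stepBal 2 F.L)
    (hκ₂ : CauchyRate.lim (beta0OfJs F κ₂) = B12Normalization.stepBal 2 F.L) (hne : beta0OfJs F κ₁ ≠ beta0OfJs F κ₂)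
    (θ : Node00.Stage13HParams F 2) (hP : θ.Provisos₁₃SepCoPH F 2) :
    ¬ ((θ.ZhUnity F 2 ∧ θ.SlotsNondegenerate₁₃ F 2) ∧ θ.Admissible F 2 ∧ B16.EndStatementBPrinted (Node00.datumOfRecord₁₃SepCoPH F 2 θ hP).C ∧ Window13 F θ hP) := by
  rintro ⟨hU, hθ, hB, hwin⟩
  exact hne ((beta0OfJs_eq_of_driftClassUniform hκs h2 F θ hP hU hθ hB hwin hκ₁).trans (beta0OfJs_eq_of_driftClassUniform hκs h2 F θ hP hU hθ hB hwin hκ₂).symm)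

/-- … and the same at every family OF THE SAME BLOCK (the named numbers and the variety read only `F.L`, §1): two variety members of `F` with different sequences empty the prefix
at every family `F'` with `F'.L = F.L`. [folklore] -/
theorem prefix_uninhabited_of_driftClassUniform_of_two_sequences_block {κs : ℕ → StepColourData}
    (hκs : ∀ F : T4Family, ∃ A : ℝ, OneLoopDrift (B12Normalization.stepBal 2 F.L) A (beta0OfJs F (κs F.L)))
    (h2 : ∀ κ : ℕ → StepColourData, (∀ F : T4Family, ∃ A : ℝ, OneLoopDrift (B12Normalization.stepBal 2 F.L) A (beta0OfJs F (κ F.L))) →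
      ∀ (F : T4Family) (θ : Node00.Stage13HParams F 2) (hP : θ.Provisos₁₃SepCoPH F 2),
      (θ.ZhUnity F 2 ∧ θ.SlotsNondegenerate₁₃ F 2) → θ.Admissible F 2 → B16.EndStatementBPrinted (Node00.datumOfRecord₁₃SepCoPH F 2 θ hP).C → Window13 F θ hP →
      RunRemAt F (κ F.L) θ hP θ.cβ)
    (F : T4Family) {κ₁ κ₂ : StepColourData} (hκ₁ : CauchyRate.lim (beta0OfJs F κ₁) = B12Normalization.stepBal 2 F.L)
    (hκ₂ : CauchyRate.lim (beta0OfJs F κ₂) = B12Normalization.stepBal 2 F.L) (hne : beta0OfJs F κ₁ ≠ beta0OfJs F κ₂)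
    (F' : T4Family) (hL : F'.L = F.L) (θ : Node00.Stage13HParams F' 2) (hP : θ.Provisos₁₃SepCoPH F' 2) :
    ¬ ((θ.ZhUnity F' 2 ∧ θ.SlotsNondegenerate₁₃ F' 2) ∧ θ.Admissible F' 2 ∧ B16.EndStatementBPrinted (Node00.datumOfRecord₁₃SepCoPH F' 2 θ hP).C ∧ Window13 F' θ hP) :=
  prefix_uninhabited_of_driftClassUniform_of_two_sequences hκs h2 F' (lim_eq_stepBal_of_L_eq hL.symm hκ₁) (lim_eq_stepBal_of_L_eq hL.symm hκ₂)
    (by rwa [← beta0OfJs_eq_of_L_eq hL.symm κ₁, ← beta0OfJs_eq_of_L_eq hL.symm κ₂]) θ hP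

end DriftClass

/-! ## §4 Bookkeeping by name: the class pair over `KAdm` ⟹ v6's registered pair and ⟹ the crux decl -/

section ByName

/-- 1ᴰ ∧ 2ᴼ(KAdm) ⟹ v6's REGISTERED PAIR `D1AtAnchoredJets ∧ RunRemAtSomeJets` (DEF-1's `d1AtAnchoredJets_of_pin` ∕ `runRemAtSomeJets_of_pin` at the witness; the rest of the class
UNREAD) — so a (β2) v7 loses nothing of v6, exactly as a (β1) v7. [folklore] -/
theorem stubTexts_of_driftClassPair
    (h1 : ∃ κ : ℕ → StepColourData, ∀ F : T4Family, ∃ A : ℝ, OneLoopDrift (B12Normalization.stepBal 2 F.L) A (beta0OfJs F (κ F.L)))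
    (h2 : ∀ κ : ℕ → StepColourData, (∀ F : T4Family, ∃ A : ℝ, OneLoopDrift (B12Normalization.stepBal 2 F.L) A (beta0OfJs F (κ F.L))) →
      ∀ (F : T4Family) (θ : Node00.Stage13HParams F 2) (hP : θ.Provisos₁₃SepCoPH F 2),
      (θ.ZhUnity F 2 ∧ θ.SlotsNondegenerate₁₃ F 2) → θ.Admissible F 2 → B16.EndStatementBPrinted (Node00.datumOfRecord₁₃SepCoPH F 2 θ hP).C → Window13 F θ hP →
      RunRemAt F (κ F.L) θ hP θ.cβ) :
    D1AtAnchoredJets ∧ RunRemAtSomeJets := by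
  obtain ⟨κs, hD1⟩ := h1
  exact ⟨d1AtAnchoredJets_of_pin κs hD1 (h2 κs hD1), runRemAtSomeJets_of_pin κs (h2 κs hD1)⟩

/-- **1ᴰ ∧ 2ᴼ(KAdm) ⟹ THE CRUX DECL BY NAME** (`Summit.QuantumFields.YangMills.Theses.BalabanUVNodes.EndpointGivenBR13SepCoPH`; §2's `EndpointGivenBR13SepCoPH_of_classPair` at
`K := KAdm`).  CONDITIONAL on the two displayed texts — whose second, by §3, prices as «variety = one fibre, or empty surface»; K2⁷ NOT closed; nothing of Bałaban asserted.
[cite: Balaban1987RG1, Thm 2 p.259 (first sentence), (1.3) p.260, Thm 3 p.264 and (5.10) p.293] -/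
theorem EndpointGivenBR13SepCoPH_of_driftClassPair
    (h1 : ∃ κ : ℕ → StepColourData, ∀ F : T4Family, ∃ A : ℝ, OneLoopDrift (B12Normalization.stepBal 2 F.L) A (beta0OfJs F (κ F.L)))
    (h2 : ∀ κ : ℕ → StepColourData, (∀ F : T4Family, ∃ A : ℝ, OneLoopDrift (B12Normalization.stepBal 2 F.L) A (beta0OfJs F (κ F.L))) →
      ∀ (F : T4Family) (θ : Node00.Stage13HParams F 2) (hP : θ.Provisos₁₃SepCoPH F 2),
      (θ.ZhUnity F 2 ∧ θ.SlotsNondegenerate₁₃ F 2) → θ.Admissible F 2 → B16.EndStatementBPrinted (Node00.datumOfRecord₁₃SepCoPH F 2 θ hP).C → Window13 F θ hP →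
      RunRemAt F (κ F.L) θ hP θ.cβ) :
    Summit.QuantumFields.YangMills.Theses.BalabanUVNodes.EndpointGivenBR13SepCoPH :=
  EndpointGivenBR13SepCoPH_of_classPair (fun κ => ∀ F : T4Family, ∃ A : ℝ, OneLoopDrift (B12Normalization.stepBal 2 F.L) A (beta0OfJs F (κ F.L)))
    (h1.elim fun κs hD1 => ⟨κs, hD1, hD1⟩) h2

end ByName

end Summit.QuantumFields.YangMills.Theorems.BalabanUVNodesK2D1ClassPairPrice

end
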